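import Summits.QuantumFields.QCD.Theorems.HeatSlicedQuarksQuarkLoopCoefficientSecondOrderExpansionAuxM

/-!
# Second-order expansion of the heat symbol — part N: continuity of the Duhamel integrands in time
(line `Sketch` of crux stmt-QuantumFields-16786, stub `stub_secondOrderExpansion`, helper file)

The four lattice series of part N (`I`, `I₁`, `I₂` and their entries) are continuous in the Duhamel time
`s ∈ [0, t]` (uniformly dominated series of continuous functions), hence interval integrable; the
pointwise split `I = θ²I₁ + θ³I₂ + I_err` at the level of entries; and the time integral of the spin
trace of `I₁` is `−e2 t`.
-/

noncomputable section

namespace Summit.QuantumFields.QCD.Cruxes.QuarkLoopCoefficient.Sketch.SecondOrderExpansion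

open Literature.MathematicalPhysics.QuantumLattice Literature.MathematicalPhysics.QuantumFieldTheory
open Literature.Probability.LatticeModels (Site)
open Summit.QuantumFields.QCD.Theorems.QuarkLoopCoefficient
open Summit.QuantumFields.QCD.Cruxes.QuarkLoopCoefficient.Sketch.HeatSeries
open Summit.QuantumFields.QCD.Cruxes.QuarkLoopCoefficient.Sketch.FreeMajorantToolkit
open Summit.QuantumFields.QCD.Cruxes.QuarkLoopCoefficient.Sketch.SymmetricGauge
open scoped Matrix ComplexConjugate

/-- The twisted generator `(V_θ f)(w) = Σ_{v ∈ nbr2 0} Ω_θ(v, w) • (ȟ_θ(v) f(w − v))` (local notation). -/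
local notation "V[" θ "]" => (fun (f : Site 4 → Spin) (w : Site 4) =>
  ∑ v ∈ nbr2 0, Complex.exp (((θ / 2 * (wedge v w : ℤ) : ℝ) : ℂ) * Complex.I) • (sqKer (symLink θ) 0 v * f (w - v)))

/-- The second-order forcing `q₂(θ, s, w)` (local notation). -/
local notation "Q₂[" θ "," s "," w "]" => (V[θ] (pert0 s) w + (θ : ℂ) • V[θ] (pert1 s) w - vtx 0 (pert0 s) w -
  (θ : ℂ) • (vtx 0 (pert1 s) w + vtx 1 (pert0 s) w))

/-- The leading forcing `F(s, w) = vtx 2 (pert0 s) w + vtx 1 (pert1 s) w` (local notation). -/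
local notation "F[" s "," w "]" => (vtx 2 (pert0 s) w + vtx 1 (pert1 s) w)

/-- The third-order forcing `q₃'(s, w) = vtx 3 (pert0 s) w + vtx 2 (pert1 s) w` (local notation). -/
local notation "Q₃[" s "," w "]" => (vtx 3 (pert0 s) w + vtx 2 (pert1 s) w)

/-- The second-order remainder `R₂(θ, u, y) = E_θ(u)(y) − E₀(u)(y) − θ E₁(u)(y)` (local notation). -/
local notation "R₂[" θ "," u "," y "]" => (symHeat θ u y - pert0 u y - (θ : ℂ) • pert1 u y)

/-! ## §34 Continuity of the building blocks in the Duhamel time -/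

/-- Continuity package of the free objects: `s ↦ E₀(t−s)`, `E₁(t−s)`, and the forcings at `s`, on `[0, t]`. -/
theorem continuity_package
    (h1 : ∀ x y : Site 4, sqKer (fun _ => (1 : ℂ)) x y = ((hhat (y - x) : ℝ) : ℂ) • (1 : Spin))
    (h3 : ∀ w : Site 4, freeKer 0 w = if w = 0 then 1 else 0)
    (h4 : ∀ (t : ℝ) (w : Site 4),
      HasDerivAt (fun s => freeKer s w) (-(∑ z ∈ nbr2 0, hhat z * freeKer t (w - z))) t)
    (h5 : ∀ s r : ℝ, 0 ≤ s → 0 ≤ r → ∀ w : Site 4,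
      HasSum (fun y : Site 4 => freeKer s y * freeKer r (w - y)) (freeKer (s + r) w))
    (h6 : ∀ t : ℝ, 0 ≤ t → ∀ (w : Site 4) (ν : Fin 4),
      t * (∑ z ∈ nbr2 0, ((z ν : ℤ) : ℝ) * hhat z * freeKer t (w - z)) + ((w ν : ℤ) : ℝ) * freeKer t w = 0)
    (θ t : ℝ) :
    (∀ (y : Site 4) (γ δ : Fin 4), ContinuousOn (fun s : ℝ => pert0 (t - s) y γ δ) (Set.Icc 0 t)) ∧
    (∀ (y : Site 4) (γ δ : Fin 4), ContinuousOn (fun s : ℝ => pert1 (t - s) y γ δ) (Set.Icc 0 t)) ∧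
    (∀ (y : Site 4) (γ δ : Fin 4), ContinuousOn (fun s : ℝ => (R₂[θ, t - s, y]) γ δ) (Set.Icc 0 t)) ∧
    (∀ (y : Site 4) (γ δ : Fin 4), ContinuousOn (fun s : ℝ => (F[s, y]) γ δ) (Set.Icc 0 t)) ∧
    (∀ (y : Site 4) (γ δ : Fin 4), ContinuousOn (fun s : ℝ => (Q₃[s, y]) γ δ) (Set.Icc 0 t)) ∧
    (∀ (y : Site 4) (γ δ : Fin 4), ContinuousOn (fun s : ℝ => (Q₂[θ, s, y]) γ δ) (Set.Icc 0 t)) := by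
  have hsub : Continuous fun s : ℝ => t - s := continuous_const.sub continuous_id
  have hmaps : Set.MapsTo (fun s : ℝ => t - s) (Set.Icc 0 t) (Set.Ici 0) := fun s hs => by
    simp only [Set.mem_Ici]; linarith [hs.2]
  have cP0 : ∀ (y : Site 4) (γ δ : Fin 4), ContinuousOn (fun s : ℝ => pert0 (t - s) y γ δ) (Set.Icc 0 t) :=
    fun y γ δ => ((continuous_pert0_apply h4 y γ δ).comp hsub).continuousOn
  have cP1 : ∀ (y : Site 4) (γ δ : Fin 4), ContinuousOn (fun s : ℝ => pert1 (t - s) y γ δ) (Set.Icc 0 t) :=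
    fun y γ δ => (continuousOn_pert1_apply h1 h3 h4 h5 h6 y γ δ).comp hsub.continuousOn hmaps
  have cE : ∀ (y : Site 4) (γ δ : Fin 4), ContinuousOn (fun s : ℝ => symHeat θ (t - s) y γ δ) (Set.Icc 0 t) :=
    fun y γ δ => ((continuous_symHeat_apply θ y γ δ).comp hsub).continuousOn
  have cR : ∀ (y : Site 4) (γ δ : Fin 4), ContinuousOn (fun s : ℝ => (R₂[θ, t - s, y]) γ δ) (Set.Icc 0 t) := by
    intro y γ δ
    have hfun : (fun s : ℝ => (R₂[θ, t - s, y]) γ δ) =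
        fun s : ℝ => symHeat θ (t - s) y γ δ - pert0 (t - s) y γ δ - (θ : ℂ) * pert1 (t - s) y γ δ := by
      funext s; simp [Matrix.sub_apply, Matrix.smul_apply]
    rw [hfun]
    exact ((cE y γ δ).sub (cP0 y γ δ)).sub (continuousOn_const.mul (cP1 y γ δ))
  -- forcings at time `s`
  have sP0 : ∀ (y : Site 4) (γ δ : Fin 4), ContinuousOn (fun s : ℝ => pert0 s y γ δ) (Set.Icc 0 t) :=
    fun y γ δ => (continuous_pert0_apply h4 y γ δ).continuousOn
  have sP1 : ∀ (y : Site 4) (γ δ : Fin 4), ContinuousOn (fun s : ℝ => pert1 s y γ δ) (Set.Icc 0 t) :=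
    fun y γ δ => (continuousOn_pert1_apply h1 h3 h4 h5 h6 y γ δ).mono fun s hs => hs.1
  have cF : ∀ (y : Site 4) (γ δ : Fin 4), ContinuousOn (fun s : ℝ => (F[s, y]) γ δ) (Set.Icc 0 t) := by
    intro y γ δ
    simp only [Matrix.add_apply]
    exact (continuousOn_vtx_apply 2 sP0 y γ δ).add (continuousOn_vtx_apply 1 sP1 y γ δ)
  have cG : ∀ (y : Site 4) (γ δ : Fin 4), ContinuousOn (fun s : ℝ => (Q₃[s, y]) γ δ) (Set.Icc 0 t) := by
    intro y γ δ
    simp only [Matrix.add_apply]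
    exact (continuousOn_vtx_apply 3 sP0 y γ δ).add (continuousOn_vtx_apply 2 sP1 y γ δ)
  have cQ : ∀ (y : Site 4) (γ δ : Fin 4), ContinuousOn (fun s : ℝ => (Q₂[θ, s, y]) γ δ) (Set.Icc 0 t) :=
    fun y γ δ => (continuousOn_forcing₂_apply h1 h3 h4 h5 h6 θ y γ δ).mono fun s hs => hs.1
  exact ⟨cP0, cP1, cR, cF, cG, cQ⟩

/-! ## §35 Continuity of the integrands and the pointwise split of the entries -/

/-- **Continuity in the Duhamel time of the three integrands** `I`, `I₁`, `I₂` (entrywise, on `[0,t]`) in the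
core regime, and the entrywise pointwise split `I = θ²I₁ + θ³I₂ + I_err`. -/
theorem integrands_continuousOn_and_split {Ck ck c₀ CE cE CR K C₁ Bm : ℝ} (hck : 0 < ck) (hc₀ : 0 < c₀) (hcE : 0 < cE)
    (hCk : 0 ≤ Ck) (hCE : 0 ≤ CE) (hCR : 0 ≤ CR) (hK : 0 ≤ K) (hC₁ : 0 ≤ C₁) (hBm : 0 ≤ Bm)
    (hk : ∀ t : ℝ, 0 ≤ t → ∀ w : Site 4, |freeKer t w| ≤ Ck * gaussProfile ck t w)
    (hT5 : ∀ c : ℝ, 0 < c → ∃ A : ℝ, ∀ t : ℝ, 0 ≤ t →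
      Summable (fun y : Site 4 => gaussProfile c t y) ∧ ∑' y : Site 4, gaussProfile c t y ≤ A)
    (hBmix : ∀ a b : ℝ, 0 ≤ a → 0 ≤ b → ∀ w : Site 4,
      Summable (fun y : Site 4 => gaussProfile ((1 - 1 / 2) * min cE (ck / 8)) a y *
        gaussProfile (min cE (ck / 8)) b (w - y)) ∧
      ∑' y : Site 4, gaussProfile ((1 - 1 / 2) * min cE (ck / 8)) a y * gaussProfile (min cE (ck / 8)) b (w - y) ≤
        Bm * gaussProfile ((1 - 1 / 2) * min cE (ck / 8)) (a + b) w)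
    (hE₁ : ∀ s : ℝ, 0 ≤ s → ∀ (y : Site 4) (γ δ : Fin 4), ‖pert1 s y γ δ‖ ≤ C₁ * (1 + s) * gaussProfile (ck / 2) s y)
    (hq : ∀ θ : ℝ, ∀ s : ℝ, 0 ≤ s → ∀ (w : Site 4) (γ δ : Fin 4),
      ‖(F[s, w]) γ δ‖ ≤ K * (1 + s) * gaussProfile (ck / 8) s w ∧
      ‖(Q₃[s, w]) γ δ‖ ≤ K * (1 + s) ^ 2 * gaussProfile (ck / 8) s w ∧
      ‖(Q₂[θ, s, w]) γ δ‖ ≤ K * (θ ^ 2 * (1 + s) + |θ| ^ 3 * (1 + s) ^ 2) * gaussProfile (ck / 8) s w ∧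
      ‖(Q₂[θ, s, w] - (θ : ℂ) ^ 2 • F[s, w] - (θ : ℂ) ^ 3 • Q₃[s, w]) γ δ‖ ≤
        K * θ ^ 4 * ((1 + s) ^ 2 + (1 + s) ^ 3) * gaussProfile (ck / 8) s w)
    (hGM : ∀ θ t : ℝ, 0 ≤ t → |θ| ≤ c₀ → |θ| * t ≤ c₀ →
      ∀ (w : Site 4) (α β : Fin 4), ‖symHeat θ t w α β‖ ≤ CE * gaussProfile cE t w)
    (hR : ∀ θ t : ℝ, 0 ≤ t → |θ| ≤ c₀ → |θ| * t ≤ c₀ → ∀ (w : Site 4) (α β : Fin 4),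
      ‖(R₂[θ, t, w]) α β‖ ≤ CR * θ ^ 2 * (1 + t) ^ 2 * gaussProfile (min cE (ck / 8) / 2) t w)
    (hcont : ∀ θ t : ℝ,
      (∀ (y : Site 4) (γ δ : Fin 4), ContinuousOn (fun s : ℝ => pert0 (t - s) y γ δ) (Set.Icc 0 t)) ∧
      (∀ (y : Site 4) (γ δ : Fin 4), ContinuousOn (fun s : ℝ => pert1 (t - s) y γ δ) (Set.Icc 0 t)) ∧
      (∀ (y : Site 4) (γ δ : Fin 4), ContinuousOn (fun s : ℝ => (R₂[θ, t - s, y]) γ δ) (Set.Icc 0 t)) ∧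
      (∀ (y : Site 4) (γ δ : Fin 4), ContinuousOn (fun s : ℝ => (F[s, y]) γ δ) (Set.Icc 0 t)) ∧
      (∀ (y : Site 4) (γ δ : Fin 4), ContinuousOn (fun s : ℝ => (Q₃[s, y]) γ δ) (Set.Icc 0 t)) ∧
      (∀ (y : Site 4) (γ δ : Fin 4), ContinuousOn (fun s : ℝ => (Q₂[θ, s, y]) γ δ) (Set.Icc 0 t)))
    (θ : ℝ) {t : ℝ} (ht : 0 ≤ t) (hθ : |θ| ≤ c₀) (hθt : |θ| * t ≤ c₀) (α : Fin 4) :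
    ContinuousOn (fun s : ℝ => (∑' y : Site 4, symHeat θ (t - s) y * Q₂[θ, s, -y]) α α) (Set.Icc 0 t) ∧
    ContinuousOn (fun s : ℝ => (∑' y : Site 4, pert0 (t - s) y * F[s, -y]) α α) (Set.Icc 0 t) ∧
    ContinuousOn (fun s : ℝ =>
      (∑' y : Site 4, (pert0 (t - s) y * Q₃[s, -y] + pert1 (t - s) y * F[s, -y])) α α) (Set.Icc 0 t) ∧
    ∀ s ∈ Set.Icc 0 t,
      (∑' y : Site 4, symHeat θ (t - s) y * Q₂[θ, s, -y]) α α =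
        (θ : ℂ) ^ 2 * (∑' y : Site 4, pert0 (t - s) y * F[s, -y]) α α +
          (θ : ℂ) ^ 3 * (∑' y : Site 4, (pert0 (t - s) y * Q₃[s, -y] + pert1 (t - s) y * F[s, -y])) α α +
          (∑' y : Site 4,
            (pert0 (t - s) y * (Q₂[θ, s, -y] - (θ : ℂ) ^ 2 • F[s, -y] - (θ : ℂ) ^ 3 • Q₃[s, -y]) +
              (θ : ℂ) • (pert1 (t - s) y * (Q₂[θ, s, -y] - (θ : ℂ) ^ 2 • F[s, -y])) +
              R₂[θ, t - s, y] * Q₂[θ, s, -y])) α α := by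
  obtain ⟨cP0, cP1, _, cF, cG, cQ⟩ := hcont θ t
  set c₁ : ℝ := min cE (ck / 8) with hc₁
  have hc₁0 : 0 < c₁ := lt_min hcE (by positivity)
  -- summability of the families at each `s ∈ [0,t]`
  have fam := fun s (hs : s ∈ Set.Icc 0 t) =>
    integrand_families hck hc₀ hcE hCk hCE hCR hK hC₁ hBm hk hBmix hE₁ hq hGM hR θ hs.1 hs.2 hθ hθt
  -- summable profile majorants at time `t`
  obtain ⟨_, hA⟩ := hT5 ck hck
  have sΓk : Summable (fun y : Site 4 => gaussProfile ck t y) := (hA t ht).1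
  obtain ⟨_, hA2⟩ := hT5 (ck / 2) (half_pos hck)
  have sΓk2 : Summable (fun y : Site 4 => gaussProfile (ck / 2) t y) := (hA2 t ht).1
  obtain ⟨_, hAE⟩ := hT5 cE hcE
  have sΓE : Summable (fun y : Site 4 => gaussProfile cE t y) := (hAE t ht).1
  -- uniform bounds of the left factors on `[0, t]` (time monotonicity of the profile)
  have bP0 : ∀ s ∈ Set.Icc 0 t, ∀ (y : Site 4) (γ δ : Fin 4),
      ‖pert0 (t - s) y γ δ‖ ≤ Ck * (1 + t) ^ 2 * gaussProfile ck t y := by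
    intro s hs y γ δ
    have hts : 0 ≤ t - s := by linarith [hs.2]
    refine (norm_pert0_apply_le hk hts y γ δ).trans ?_
    rw [mul_assoc]
    exact mul_le_mul_of_nonneg_left (gaussProfile_le_of_le_time hck.le hts (by linarith [hs.1]) y) hCk
  have bP1 : ∀ s ∈ Set.Icc 0 t, ∀ (y : Site 4) (γ δ : Fin 4),
      ‖pert1 (t - s) y γ δ‖ ≤ C₁ * (1 + t) * (1 + t) ^ 2 * gaussProfile (ck / 2) t y := by
    intro s hs y γ δ
    have hts : 0 ≤ t - s := by linarith [hs.2]
    refine (hE₁ (t - s) hts y γ δ).trans ?_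
    have h1 := gaussProfile_le_of_le_time (half_pos hck).le hts (by linarith [hs.1] : t - s ≤ t) y
    have hΓ := gaussProfile_nonneg (ck / 2) (t - s) y
    calc C₁ * (1 + (t - s)) * gaussProfile (ck / 2) (t - s) y ≤ C₁ * (1 + t) * gaussProfile (ck / 2) (t - s) y := by
          gcongr; linarith [hs.1]
      _ ≤ C₁ * (1 + t) * ((1 + t) ^ 2 * gaussProfile (ck / 2) t y) := mul_le_mul_of_nonneg_left h1 (by positivity)
      _ = _ := by ring
  have bE : ∀ s ∈ Set.Icc 0 t, ∀ (y : Site 4) (γ δ : Fin 4),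
      ‖symHeat θ (t - s) y γ δ‖ ≤ CE * (1 + t) ^ 2 * gaussProfile cE t y := by
    intro s hs y γ δ
    have hts : 0 ≤ t - s := by linarith [hs.2]
    refine (hGM θ (t - s) hts hθ ?_ y γ δ).trans ?_
    · calc |θ| * (t - s) ≤ |θ| * t := by gcongr; linarith [hs.1]
        _ ≤ c₀ := hθt
    · rw [mul_assoc]
      exact mul_le_mul_of_nonneg_left (gaussProfile_le_of_le_time hcE.le hts (by linarith [hs.1]) y) hCE
  -- uniform bounds of the right factors on `[0, t]`
  have bF : ∀ s ∈ Set.Icc 0 t, ∀ (y : Site 4) (γ δ : Fin 4), ‖(F[s, y]) γ δ‖ ≤ K * (1 + t) := by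
    intro s hs y γ δ
    refine ((hq θ s hs.1 y γ δ).1).trans ?_
    calc K * (1 + s) * gaussProfile (ck / 8) s y ≤ K * (1 + s) * 1 :=
          mul_le_mul_of_nonneg_left (gaussProfile_le_one (by positivity) hs.1 y) (by nlinarith [hs.1])
      _ ≤ K * (1 + t) := by rw [mul_one]; gcongr; exact hs.2
  have bG : ∀ s ∈ Set.Icc 0 t, ∀ (y : Site 4) (γ δ : Fin 4), ‖(Q₃[s, y]) γ δ‖ ≤ K * (1 + t) ^ 2 := by
    intro s hs y γ δ
    refine ((hq θ s hs.1 y γ δ).2.1).trans ?_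
    have hs0 : 0 ≤ 1 + s := by linarith [hs.1]
    calc K * (1 + s) ^ 2 * gaussProfile (ck / 8) s y ≤ K * (1 + s) ^ 2 * 1 :=
          mul_le_mul_of_nonneg_left (gaussProfile_le_one (by positivity) hs.1 y) (by positivity)
      _ ≤ K * (1 + t) ^ 2 := by rw [mul_one]; gcongr; exact hs.2
  have bQ : ∀ s ∈ Set.Icc 0 t, ∀ (y : Site 4) (γ δ : Fin 4),
      ‖(Q₂[θ, s, y]) γ δ‖ ≤ K * (θ ^ 2 * (1 + t) + |θ| ^ 3 * (1 + t) ^ 2) := by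
    intro s hs y γ δ
    refine ((hq θ s hs.1 y γ δ).2.2.1).trans ?_
    have hs0 : 0 ≤ 1 + s := by linarith [hs.1]
    have hpos : 0 ≤ K * (θ ^ 2 * (1 + s) + |θ| ^ 3 * (1 + s) ^ 2) := by positivity
    calc K * (θ ^ 2 * (1 + s) + |θ| ^ 3 * (1 + s) ^ 2) * gaussProfile (ck / 8) s y
        ≤ K * (θ ^ 2 * (1 + s) + |θ| ^ 3 * (1 + s) ^ 2) * 1 :=
          mul_le_mul_of_nonneg_left (gaussProfile_le_one (by positivity) hs.1 y) hpos
      _ ≤ K * (θ ^ 2 * (1 + t) + |θ| ^ 3 * (1 + t) ^ 2) := by rw [mul_one]; gcongr <;> linarith [hs.2]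
  -- the three scalar series are continuous
  have cI : ContinuousOn (fun s : ℝ => ∑' y : Site 4, (symHeat θ (t - s) y * Q₂[θ, s, -y]) α α) (Set.Icc 0 t) :=
    continuousOn_tsum_mul_apply (A := fun s y => symHeat θ (t - s) y) (B := fun s y => Q₂[θ, s, y]) sΓE
      (fun y γ δ => ((continuous_symHeat_apply θ y γ δ).comp (continuous_const.sub continuous_id)).continuousOn)
      cQ bE bQ α α
  have cI₁ : ContinuousOn (fun s : ℝ => ∑' y : Site 4, (pert0 (t - s) y * F[s, -y]) α α) (Set.Icc 0 t) :=
    continuousOn_tsum_mul_apply (A := fun s y => pert0 (t - s) y) (B := fun s y => F[s, y]) sΓk cP0 cF bP0 bF α α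
  have cI₂a : ContinuousOn (fun s : ℝ => ∑' y : Site 4, (pert0 (t - s) y * Q₃[s, -y]) α α) (Set.Icc 0 t) :=
    continuousOn_tsum_mul_apply (A := fun s y => pert0 (t - s) y) (B := fun s y => Q₃[s, y]) sΓk cP0 cG bP0 bG α α
  have cI₂b : ContinuousOn (fun s : ℝ => ∑' y : Site 4, (pert1 (t - s) y * F[s, -y]) α α) (Set.Icc 0 t) :=
    continuousOn_tsum_mul_apply (A := fun s y => pert1 (t - s) y) (B := fun s y => F[s, y]) sΓk2 cP1 cF bP1 bF α α
  refine ⟨?_, ?_, ?_, fun s hs => ?_⟩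
  · refine cI.congr fun s hs => ?_
    exact tsum_apply_apply (fam s hs).2.2.2.1 α α
  · refine cI₁.congr fun s hs => ?_
    exact tsum_apply_apply (fam s hs).1 α α
  · refine (cI₂a.add cI₂b).congr fun s hs => ?_
    obtain ⟨f1, f2, _⟩ := fam s hs
    have sa : Summable (fun y : Site 4 => pert0 (t - s) y * Q₃[s, -y]) := by
      -- `E₀ q₃'` alone: difference of the summable pair family and `E₁ F`
      have sb : Summable (fun y : Site 4 => pert1 (t - s) y * F[s, -y]) := by
        have hts : 0 ≤ t - s := by linarith [hs.2]
        have c1E : ∀ (y : Site 4) (α γ : Fin 4), ‖pert1 (t - s) y α γ‖ ≤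
            C₁ * (1 + t) * gaussProfile (min cE (ck / 8) / 2) (t - s) y := by
          intro y α γ
          refine (hE₁ (t - s) hts y α γ).trans ?_
          have hΓ := gaussProfile_nonneg (ck / 2) (t - s) y
          calc C₁ * (1 + (t - s)) * gaussProfile (ck / 2) (t - s) y ≤ C₁ * (1 + t) * gaussProfile (ck / 2) (t - s) y := by
                gcongr; linarith [hs.1]
            _ ≤ _ := mul_le_mul_of_nonneg_left (gaussProfile_anti (by
                have := min_le_right cE (ck / 8); linarith) hts y) (by positivity)
        have cFb : ∀ (y : Site 4) (γ β : Fin 4), ‖(F[s, y]) γ β‖ ≤ K * (1 + s) * gaussProfile (min cE (ck / 8)) s y :=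
          fun y γ β => ((hq θ s hs.1 y γ β).1).trans (mul_le_mul_of_nonneg_left
            (gaussProfile_anti (min_le_right _ _) hs.1 y) (by nlinarith [hs.1]))
        exact (originConv_summable_and_norm_le hBmix (by positivity) (by nlinarith [hs.1]) hts hs.1 c1E cFb).1
      have := f2.sub sb
      simpa using this
    have sb : Summable (fun y : Site 4 => pert1 (t - s) y * F[s, -y]) := by
      have := f2.sub sa
      simpa using this
    simp only [Pi.add_apply]
    rw [tsum_apply_apply f2 α α]
    simp only [Matrix.add_apply]
    exact (Pi.summable.mp (Pi.summable.mp sa α) α).tsum_add (Pi.summable.mp (Pi.summable.mp sb α) α)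
  · -- the pointwise split of the entries
    obtain ⟨f1, f2, f3, f4, _⟩ := fam s hs
    have hpt : ∀ y : Site 4, symHeat θ (t - s) y * Q₂[θ, s, -y] =
        (θ : ℂ) ^ 2 • (pert0 (t - s) y * F[s, -y]) +
          (θ : ℂ) ^ 3 • (pert0 (t - s) y * Q₃[s, -y] + pert1 (t - s) y * F[s, -y]) +
          (pert0 (t - s) y * (Q₂[θ, s, -y] - (θ : ℂ) ^ 2 • F[s, -y] - (θ : ℂ) ^ 3 • Q₃[s, -y]) +
            (θ : ℂ) • (pert1 (t - s) y * (Q₂[θ, s, -y] - (θ : ℂ) ^ 2 • F[s, -y])) +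
            R₂[θ, t - s, y] * Q₂[θ, s, -y]) :=
      fun y => integrand_split (θ : ℂ) _ _ _ _ _ _
    have hsum : (∑' y : Site 4, symHeat θ (t - s) y * Q₂[θ, s, -y]) =
        (θ : ℂ) ^ 2 • (∑' y : Site 4, pert0 (t - s) y * F[s, -y]) +
          (θ : ℂ) ^ 3 • (∑' y : Site 4, (pert0 (t - s) y * Q₃[s, -y] + pert1 (t - s) y * F[s, -y])) +
          (∑' y : Site 4,
            (pert0 (t - s) y * (Q₂[θ, s, -y] - (θ : ℂ) ^ 2 • F[s, -y] - (θ : ℂ) ^ 3 • Q₃[s, -y]) +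
              (θ : ℂ) • (pert1 (t - s) y * (Q₂[θ, s, -y] - (θ : ℂ) ^ 2 • F[s, -y])) +
              R₂[θ, t - s, y] * Q₂[θ, s, -y])) := by
      rw [tsum_congr hpt, ((f1.const_smul _).add (f2.const_smul _)).tsum_add f3,
        (f1.const_smul _).tsum_add (f2.const_smul _), f1.tsum_const_smul, f2.tsum_const_smul]
    rw [hsum]
    simp only [Matrix.add_apply, Matrix.smul_apply, smul_eq_mul]

/-! ## Registered headline -/

/-- Registered headline of this helper file (aux stub `stub_secondOrderExpansionAuxN` of crux
stmt-QuantumFields-16786, line `Sketch`): continuity in time of the entries of `E₀(t − s)` on `[0, t]`. -/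
theorem stub_secondOrderExpansionAuxN : (∀ (r : ℝ) (w : Site 4), HasDerivAt (fun s => freeKer s w) (-(∑ z ∈ nbr2 0, hhat z * freeKer r (w - z))) r) → ∀ (t : ℝ) (y : Site 4) (γ δ : Fin 4), ContinuousOn (fun s : ℝ => pert0 (t - s) y γ δ) (Set.Icc 0 t) :=
  fun h4 _ y γ δ => ((continuous_pert0_apply h4 y γ δ).comp (continuous_const.sub continuous_id)).continuousOn

end Summit.QuantumFields.QCD.Cruxes.QuarkLoopCoefficient.Sketch.SecondOrderExpansion

end
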